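import Summits.AtomisticToContinuum.FouriersLaw.Theorems.EmbeddedDrudeMourreNessUniqueDefect
import Summits.AtomisticToContinuum.FouriersLaw.Theorems.VanishingNoiseTransferNoisyFourierFlipResolventIBP

/-!
# Resolvent identification of weak flip steady states, part 3: height and cross terms of the truncation defect with a source

Helper file for crux `NoisyFourier` (stmt-AtomisticToContinuum-11977, route `VanishingNoiseTransfer`), line
`sector-dirichlet-gluing`, registered stub `stub_flipSteadyState_eq_bind_resolventKernel`. For smooth confining
potentials, `N ≥ 1`, `T_L, T_R ≥ 0`, and a `C²` integrable solution `ρ ≥ 0` of `L̂ρ + cρ + g = 0` with a continuous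
integrable source `g`, the defect `E = L̂ f + c f + χ(H/R) m_M'(ρ) g` of the truncations `f_{R,M} = χ(H/R) m_M(ρ)`
obeys (`integral_abs_defect_le_src`)
`∫ |E| ≤ K₀ ∫ θ_M(ρ) + ∫ θ_M^g + K₃ ∫_{R ≤ H} ρ + (K₄/√R)[ε W (m₀ + δ V) + (m₀ + m_g)/ε]`,
`θ_M(s) = s[M < s]`, `θ_M^g = |g| [M < ρ]`, `m₀ = ∫ρ`, `m_g = ∫|g|`, `V = |{H ≤ 4R}|`, `W = 1 + arsinh²(2M/δ)`:
the `ε = 0` file `EmbeddedDrudeMourreNessUniqueDefect.lean` verbatim, with the Fisher bounds of part 1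
(`half_integral_weightedFisher_le_src`, source cost `∫ a |F'(ρ)| |g|`). No definitions.
-/

noncomputable section

open MeasureTheory ProbabilityTheory Filter Topology Set
open scoped ContDiff NNReal ENNReal

namespace Summit.AtomisticToContinuum.FouriersLaw.Theorems.NoisyFourier.FlipResolvent

open Literature.MathematicalPhysics.KineticTheory.HeatConduction
open Literature.MathematicalPhysics.KineticTheory Literature.Probability.Process OscillatorChain
open Literature.Analysis.Distribution
open Summit.AtomisticToContinuum.FouriersLaw.Theorems.SubdiffusiveBondHeat
open Summit.AtomisticToContinuum.FouriersLaw.Theorems.NessUnique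

variable {N : ℕ} {P : OscillatorChain}

variable {T_L T_R : ℝ} {ρ : PhaseSpace N → ℝ} {c : ℝ} {g : PhaseSpace N → ℝ}

/-! ### The height terms -/

section Height

variable (hU : ContDiff ℝ ((⊤ : ℕ∞) : WithTop ℕ∞) P.U)
  (hV : ContDiff ℝ ((⊤ : ℕ∞) : WithTop ℕ∞) P.V) (hN : 0 < N)
  (hρ : ContDiff ℝ 2 ρ) (hρ0 : ∀ x, 0 ≤ ρ x)
  (hρi : Integrable ρ) (hg : Continuous g) (hgi : Integrable g)
  (hpde : ∀ x, sdeGenerator (fun y => -P.drift N y) (P.bathVecL N T_L) (P.bathVecR N T_R) ρ x +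
    c * ρ x + g x = 0)

include hU hV hN hρ hρ0 hρi hg hgi hpde in
/-- **The height terms**: `½ ∫ χ(H/R) (-m_M''(ρ)) Γ(ρ,ρ) ≤ (K + |c| + |2γ - c|) ∫ θ_M(ρ) + ∫ |g| [M < ρ]` whenever
`|L χ(H/R)| ≤ K` (entropy-type identity with `F(s) = s - m_M(s)`, `0 ≤ F, sF' - F ≤ θ_M`, `F' = 1 - χ(·/M) ∈ [0,1]`
vanishing on `[0, M]`). [folklore] -/
theorem half_integral_height_le_src (hP : P.IsConfining) {M R K : ℝ} (hM : 0 < M) (hR : 0 < R)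
    (hK : ∀ x, |sdeGenerator (P.drift N) (P.bathVecL N T_L) (P.bathVecR N T_R)
      (fun y => smoothCutoff (P.hamiltonian N y / R)) x| ≤ K) :
    (1 / 2) * ∫ x, smoothCutoff (P.hamiltonian N x / R) * (-(deriv smoothCutoff (ρ x / M) / M) *
        carreDuChamp (P.bathVecL N T_L) (P.bathVecR N T_R) ρ ρ x) ≤
      1 * (K + |c| + |2 * P.γ - c|) * (∫ x, (if M < ρ x then ρ x else 0)) +
        ∫ x, (if M < ρ x then |g x| else 0) := by
  have hU2 : ContDiff ℝ 2 P.U := hU.of_le (by norm_cast)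
  have hV2 : ContDiff ℝ 2 P.V := hV.of_le (by norm_cast)
  have hF : ∀ u : ℝ, HasDerivAt (fun s => s - ∫ σ in (0:ℝ)..s, smoothCutoff (σ / M))
      (1 - smoothCutoff (u / M)) u := fun u => (hasDerivAt_id u).sub (hasDerivAt_heightProfile M u)
  have hF' : ∀ u : ℝ, HasDerivAt (fun s => 1 - smoothCutoff (s / M))
      (-(deriv smoothCutoff (u / M) / M)) u := fun u => (hasDerivAt_cutoffProfile M u).const_sub 1
  have hF'' : Continuous fun u : ℝ => -(deriv smoothCutoff (u / M) / M) :=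
    ((((contDiff_smoothCutoff (n := 1)).continuous_deriv le_rfl).comp (continuous_id.div_const M)).div_const M).neg
  have hθ : Integrable fun x => (if M < ρ x then ρ x else 0) := by
    have e : (fun x => (if M < ρ x then ρ x else 0)) = {x | M < ρ x}.indicator ρ := by
      funext x; simp only [Set.indicator_apply, Set.mem_setOf_eq]
    rw [e]
    exact hρi.indicator (measurableSet_lt measurable_const hρ.continuous.measurable)
  have hθg : Integrable fun x => (if M < ρ x then |g x| else 0) := by
    have e : (fun x => (if M < ρ x then |g x| else 0)) = {x | M < ρ x}.indicator (fun x => |g x|) := by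
      funext x; simp only [Set.indicator_apply, Set.mem_setOf_eq]
    rw [e]
    exact hgi.abs.indicator (measurableSet_lt measurable_const hρ.continuous.measurable)
  have h := half_integral_weightedFisher_le_src P hU hV hN T_L T_R hρ hρ0 hg hpde hF hF' hF''
    (θ := fun s => if M < s then s else 0) (ℓ := 1)
    (fun s hs => (sub_heightProfile_bounds hM hs).1) (fun s hs => (sub_heightProfile_bounds hM hs).2.1)
    (fun s hs => (sub_heightProfile_bounds hM hs).2.2.1) (fun s hs => (sub_heightProfile_bounds hM hs).2.2.2)
    hθ (contDiff_energyCutoff hU2 hV2 N R) (hasCompactSupport_energyCutoff hP N hR)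
    (fun x => (energyCutoff_mem_Icc (P := P) R x).1) (fun x => (energyCutoff_mem_Icc (P := P) R x).2) hK
  refine h.trans (add_le_add le_rfl ?_)
  -- the source term: `a (1 - χ(ρ/M)) |g| ≤ |g| [M < ρ]`
  have hi : Integrable fun x => smoothCutoff (P.hamiltonian N x / R) * (|1 - smoothCutoff (ρ x / M)| * |g x|) :=
    ((contDiff_energyCutoff hU2 hV2 N R).continuous.mul
      ((continuous_const.sub ((contDiff_smoothCutoff (n := 0)).continuous.comp
        (hρ.continuous.div_const M))).abs.mul hg.abs)).integrable_of_hasCompactSupport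
      (hasCompactSupport_energyCutoff hP N hR).mul_right
  refine integral_mono hi hθg fun x => ?_
  have hax := energyCutoff_mem_Icc (P := P) R x
  by_cases hx : M < ρ x
  · rw [if_pos hx]
    have h1 : |1 - smoothCutoff (ρ x / M)| ≤ 1 := by
      rw [abs_of_nonneg (sub_nonneg.2 (smoothCutoff_le_one _))]
      linarith [smoothCutoff_nonneg (ρ x / M)]
    calc smoothCutoff (P.hamiltonian N x / R) * (|1 - smoothCutoff (ρ x / M)| * |g x|)
        ≤ 1 * (1 * |g x|) :=
          mul_le_mul hax.2 (mul_le_mul_of_nonneg_right h1 (abs_nonneg _))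
            (mul_nonneg (abs_nonneg _) (abs_nonneg _)) zero_le_one
      _ = |g x| := by ring
  · rw [if_neg hx, deriv_heightProfile_eq_one hM (not_lt.1 hx), sub_self, abs_zero, zero_mul, mul_zero]


end Height

/-! ### The cross term -/

section Cross

variable (hU : ContDiff ℝ ((⊤ : ℕ∞) : WithTop ℕ∞) P.U)
  (hV : ContDiff ℝ ((⊤ : ℕ∞) : WithTop ℕ∞) P.V) (hN : 0 < N)
  (hρ : ContDiff ℝ 2 ρ) (hρ0 : ∀ x, 0 ≤ ρ x)
  (hρi : Integrable ρ) (hg : Continuous g) (hgi : Integrable g)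
  (hpde : ∀ x, sdeGenerator (fun y => -P.drift N y) (P.bathVecL N T_L) (P.bathVecR N T_R) ρ x +
    c * ρ x + g x = 0)

include hU hV hN hρ hρ0 hρi hg hgi hpde in
/-- **The cross term with a source.** For `R ≥ 1`, `M, δ, ε > 0` (with the constants `K₁` of `|L χ(H/2R)| ≤ K₁`
and `C` of `|Dχ(H/R)·bathVec| ≤ C|c|/√R`):
`∫ χ(ρ/M) |Γ(χ(H/R), ρ)| ≤ (C(c_L+c_R)/√R) [ε W (m₀ + δ |{H ≤ 4R}|) + (π/2)((K₁ + |c| + |2γ-c|) m₀ + m_g)/ε]`,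
`c_b = √(2γT_b)`, `m₀ = ∫ρ`, `m_g = ∫|g|`, `W = 1 + arsinh²(2M/δ)`. [folklore] -/
theorem integral_cross_le_src (hP : P.IsConfining) {K₁ C : ℝ} (hK₁ : ∀ R : ℝ, 1 ≤ R → ∀ x,
      |sdeGenerator (P.drift N) (P.bathVecL N T_L) (P.bathVecR N T_R)
        (fun y => smoothCutoff (P.hamiltonian N y / R)) x| ≤ K₁)
    (hC0 : 0 ≤ C) (hC : ∀ R : ℝ, 1 ≤ R → ∀ (x : PhaseSpace N) {k : ℕ} (hk : k < N) (c : ℝ),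
      |fderiv ℝ (fun y => smoothCutoff (P.hamiltonian N y / R)) x (bathVec N k c)| ≤ C * |c| / Real.sqrt R ∧
      (¬ (R ≤ P.hamiltonian N x ∧ P.hamiltonian N x ≤ 2 * R) →
        fderiv ℝ (fun y => smoothCutoff (P.hamiltonian N y / R)) x (bathVec N k c) = 0))
    {R M δ ε : ℝ} (hR : 1 ≤ R) (hM : 0 < M) (hδ : 0 < δ) (hε : 0 < ε) :
    ∫ x, smoothCutoff (ρ x / M) *
        |carreDuChamp (P.bathVecL N T_L) (P.bathVecR N T_R) (fun y => smoothCutoff (P.hamiltonian N y / R)) ρ x| ≤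
      C * (|Real.sqrt (2 * P.γ * T_L)| + |Real.sqrt (2 * P.γ * T_R)|) / Real.sqrt R *
        (ε * (1 + Real.arsinh (2 * M / δ) ^ 2) *
            ((∫ x, ρ x) + δ * (volume {x | P.hamiltonian N x ≤ 4 * R}).toReal) +
          Real.pi / 2 * ((K₁ + |c| + |2 * P.γ - c|) * (∫ x, ρ x) + ∫ x, |g x|) / ε) := by
  have hU2 : ContDiff ℝ 2 P.U := hU.of_le (by norm_cast)
  have hV2 : ContDiff ℝ 2 P.V := hV.of_le (by norm_cast)
  have hR0 : 0 < R := by linarith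
  have h2R : 1 ≤ 2 * R := by linarith
  have h2R0 : 0 < 2 * R := by linarith
  set vL := P.bathVecL N T_L with hvL
  set vR := P.bathVecR N T_R with hvR
  set cL := Real.sqrt (2 * P.γ * T_L)
  set cR := Real.sqrt (2 * P.γ * T_R)
  set a : PhaseSpace N → ℝ := fun y => smoothCutoff (P.hamiltonian N y / R) with ha
  set ah : PhaseSpace N → ℝ := fun y => smoothCutoff (P.hamiltonian N y / (2 * R)) with hah
  set W := 1 + Real.arsinh (2 * M / δ) ^ 2 with hW
  set Fc : ℝ → ℝ := fun s => 1 / (1 + Real.arsinh (s / δ) ^ 2) * ((Real.sqrt (1 + (s / δ) ^ 2))⁻¹ * (1 / δ))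
    with hFc
  set Γρ := carreDuChamp vL vR ρ ρ with hΓρ
  set sh : Set (PhaseSpace N) := {x | R ≤ P.hamiltonian N x ∧ P.hamiltonian N x ≤ 2 * R} with hsh
  set Cc := C * (|cL| + |cR|) with hCc
  have hCc0 : 0 ≤ Cc := by positivity
  have hW1 : 1 ≤ W := by rw [hW]; nlinarith [sq_nonneg (Real.arsinh (2 * M / δ))]
  have hρc : Continuous ρ := hρ.continuous
  have hρm : Measurable ρ := hρc.measurable
  have hHc : Continuous (P.hamiltonian N) := (P.contDiff_hamiltonian hU2 hV2 N).continuous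
  have hsh_meas : MeasurableSet sh :=
    (measurableSet_le measurable_const hHc.measurable).inter (measurableSet_le hHc.measurable measurable_const)
  have hsh_sub : sh ⊆ {x | P.hamiltonian N x ≤ 4 * R} := fun x hx => by
    simp only [Set.mem_setOf_eq] at hx ⊢; linarith [hx.2]
  have hV4 : volume {x | P.hamiltonian N x ≤ 4 * R} < (⊤ : ℝ≥0∞) :=
    (hP.isCompact_setOf_hamiltonian_le N (4 * R)).measure_lt_top
  have hVsh : volume sh < (⊤ : ℝ≥0∞) := (measure_mono hsh_sub).trans_lt hV4
  set Φ : PhaseSpace N → ℝ := fun x =>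
    Cc / Real.sqrt R * (sh.indicator (fun x => ε * W * (ρ x + δ)) x + ah x * (Fc (ρ x) * Γρ x) / (2 * ε))
    with hΦ
  have hFc0 : ∀ s, 0 < Fc s := fun s => fisherCurv_pos hδ s
  have hΓρ0 : ∀ x, 0 ≤ Γρ x := fun x => carreDuChamp_self_nonneg vL vR ρ x
  have hah_mem : ∀ x, ah x ∈ Icc (0:ℝ) 1 := fun x => energyCutoff_mem_Icc (P := P) (2 * R) x
  have hpt : ∀ x, smoothCutoff (ρ x / M) * |carreDuChamp vL vR a ρ x| ≤ Φ x := by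
    intro x
    have hDa : ∀ (k : ℕ) (hk : k < N) (c : ℝ), |fderiv ℝ a x (bathVec N k c)| ≤ C * |c| / Real.sqrt R ∧
        (x ∉ sh → fderiv ℝ a x (bathVec N k c) = 0) := fun k hk c => hC R hR x hk c
    have hN1 : N - 1 < N := Nat.sub_lt hN one_pos
    have evL : vL = bathVec N 0 cL := rfl
    have evR : vR = bathVec N (N - 1) cR := rfl
    have hL := hDa 0 hN cL
    have hRt := hDa (N - 1) hN1 cR
    rw [← evL] at hL
    rw [← evR] at hRt
    rw [carreDuChamp_def]
    by_cases hx : x ∈ sh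
    · -- on the shell
      rw [hΦ]; dsimp only
      rw [Set.indicator_of_mem hx]
      have hm := fun y : ℝ => deriv_height_mul_abs_le hM hδ hε (hρ0 x) y
      have h1 : smoothCutoff (ρ x / M) * |fderiv ℝ a x vL * fderiv ℝ ρ x vL + fderiv ℝ a x vR * fderiv ℝ ρ x vR| ≤
          (Cc / Real.sqrt R) * (smoothCutoff (ρ x / M) * |fderiv ℝ ρ x vL| +
            smoothCutoff (ρ x / M) * |fderiv ℝ ρ x vR|) := by
        have hm0 : 0 ≤ smoothCutoff (ρ x / M) := smoothCutoff_nonneg _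
        have hbL : |fderiv ℝ a x vL| ≤ Cc / Real.sqrt R := by
          refine hL.1.trans ?_
          rw [hCc]; apply div_le_div_of_nonneg_right _ (Real.sqrt_nonneg _)
          nlinarith [abs_nonneg cL, abs_nonneg cR]
        have hbR : |fderiv ℝ a x vR| ≤ Cc / Real.sqrt R := by
          refine hRt.1.trans ?_
          rw [hCc]; apply div_le_div_of_nonneg_right _ (Real.sqrt_nonneg _)
          nlinarith [abs_nonneg cL, abs_nonneg cR]
        calc smoothCutoff (ρ x / M) * |fderiv ℝ a x vL * fderiv ℝ ρ x vL + fderiv ℝ a x vR * fderiv ℝ ρ x vR|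
            ≤ smoothCutoff (ρ x / M) * (|fderiv ℝ a x vL| * |fderiv ℝ ρ x vL| +
                |fderiv ℝ a x vR| * |fderiv ℝ ρ x vR|) := by
              refine mul_le_mul_of_nonneg_left ((abs_add_le _ _).trans ?_) hm0
              rw [abs_mul, abs_mul]
          _ ≤ smoothCutoff (ρ x / M) * ((Cc / Real.sqrt R) * |fderiv ℝ ρ x vL| +
                (Cc / Real.sqrt R) * |fderiv ℝ ρ x vR|) := by
              refine mul_le_mul_of_nonneg_left (add_le_add ?_ ?_) hm0
              · exact mul_le_mul_of_nonneg_right hbL (abs_nonneg _)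
              · exact mul_le_mul_of_nonneg_right hbR (abs_nonneg _)
          _ = _ := by ring
      refine h1.trans ?_
      have hCR : 0 ≤ Cc / Real.sqrt R := div_nonneg hCc0 (Real.sqrt_nonneg _)
      refine mul_le_mul_of_nonneg_left ?_ hCR
      have hA := hm (fderiv ℝ ρ x vL)
      have hB := hm (fderiv ℝ ρ x vR)
      have hah1 : ah x = 1 := energyCutoff_eq_one h2R0 hx.2
      rw [hah1, one_mul, hΓρ, carreDuChamp_self]
      have e : (ε * ((1 + Real.arsinh (2 * M / δ) ^ 2) * (ρ x + δ)) + Fc (ρ x) * fderiv ℝ ρ x vL ^ 2 / ε) / 2 +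
          (ε * ((1 + Real.arsinh (2 * M / δ) ^ 2) * (ρ x + δ)) + Fc (ρ x) * fderiv ℝ ρ x vR ^ 2 / ε) / 2 =
          ε * W * (ρ x + δ) + Fc (ρ x) * (fderiv ℝ ρ x vL ^ 2 + fderiv ℝ ρ x vR ^ 2) / (2 * ε) := by
        rw [hW]; field_simp; ring
      linarith [hA, hB, e.le, e.ge]
    · -- off the shell both bath derivatives of the cutoff vanish
      rw [hL.2 hx, hRt.2 hx]
      simp only [zero_mul, add_zero, abs_zero, mul_zero]
      rw [hΦ]; dsimp only
      rw [Set.indicator_of_notMem hx, zero_add]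
      have : 0 ≤ ah x * (Fc (ρ x) * Γρ x) / (2 * ε) :=
        div_nonneg (mul_nonneg (hah_mem x).1 (mul_nonneg (hFc0 _).le (hΓρ0 x))) (by linarith)
      exact mul_nonneg (div_nonneg hCc0 (Real.sqrt_nonneg _)) this
  have ha2 : ContDiff ℝ 2 a := contDiff_energyCutoff hU2 hV2 N R
  have hah2 : ContDiff ℝ 2 ah := contDiff_energyCutoff hU2 hV2 N (2 * R)
  have hac : HasCompactSupport a := hasCompactSupport_energyCutoff hP N hR0
  have hahc : HasCompactSupport ah := hasCompactSupport_energyCutoff hP N h2R0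
  have hFcc : Continuous Fc := continuous_fisherCurv δ
  have hi_lhs : Integrable fun x => smoothCutoff (ρ x / M) * |carreDuChamp vL vR a ρ x| :=
    ((((contDiff_smoothCutoff (n := 0)).continuous.comp (hρc.div_const M))).mul
      (continuous_carreDuChamp vL vR ha2 hρ).abs).integrable_of_hasCompactSupport
      (hasCompactSupport_carreDuChamp vL vR hac ρ).abs.mul_left
  have hi1 : Integrable (sh.indicator fun x => ε * W * (ρ x + δ)) := by
    refine IntegrableOn.integrable_indicator ?_ hsh_meas
    exact (hρi.integrableOn.add (integrableOn_const (C := δ) hVsh.ne)).const_mul (ε * W)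
  have hi2 : Integrable fun x => ah x * (Fc (ρ x) * Γρ x) / (2 * ε) :=
    ((hah2.continuous.mul ((hFcc.comp hρc).mul (continuous_carreDuChamp vL vR hρ hρ))).integrable_of_hasCompactSupport
      hahc.mul_right).div_const _
  have hiΦ : Integrable Φ := (hi1.add hi2).const_mul _
  have b1 : ∫ x, sh.indicator (fun x => ε * W * (ρ x + δ)) x ≤
      ε * W * ((∫ x, ρ x) + δ * (volume {x | P.hamiltonian N x ≤ 4 * R}).toReal) := by
    rw [integral_indicator hsh_meas, integral_const_mul, integral_add hρi.integrableOn
      (integrableOn_const (C := δ) hVsh.ne), setIntegral_const, smul_eq_mul]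
    have hεW : 0 ≤ ε * W := by positivity
    refine mul_le_mul_of_nonneg_left (add_le_add ?_ ?_) hεW
    · exact setIntegral_le_integral hρi (Eventually.of_forall hρ0)
    · rw [mul_comm]
      refine mul_le_mul_of_nonneg_left ?_ hδ.le
      exact measureReal_mono hsh_sub hV4.ne
  -- the Fisher bound with the profile `F_δ` (slope `≤ π/2`) and the source
  have hfisher := half_integral_weightedFisher_le_src P hU hV hN T_L T_R hρ hρ0 hg hpde
    (hasDerivAt_fisherProfile δ) (hasDerivAt_fisherSlope δ) (continuous_fisherCurv δ)
    (θ := fun s => s) (ℓ := Real.pi / 2)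
    (fun s hs => (fisherProfile_bounds hδ hs).1) (fun s hs => (fisherProfile_bounds hδ hs).2.1)
    (fun s hs => (fisherProfile_bounds hδ hs).2.2.1) (fun s hs => (fisherProfile_bounds hδ hs).2.2.2)
    hρi hah2 hahc (fun x => (hah_mem x).1) (fun x => (hah_mem x).2) (hK₁ (2 * R) h2R)
  have hsrc : ∫ x, ah x * (|Real.arctan (Real.arsinh (ρ x / δ))| * |g x|) ≤ Real.pi / 2 * ∫ x, |g x| := by
    rw [← integral_const_mul]
    refine integral_mono ?_ (hgi.abs.const_mul _) fun x => ?_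
    · exact ((hah2.continuous.mul (((continuous_fisherSlope δ).comp hρc).abs.mul hg.abs))).integrable_of_hasCompactSupport
        hahc.mul_right
    · have hsl := fisherSlope_mem_Icc hδ (hρ0 x)
      rw [abs_of_nonneg hsl.1]
      calc ah x * (Real.arctan (Real.arsinh (ρ x / δ)) * |g x|) ≤ 1 * (Real.pi / 2 * |g x|) :=
            mul_le_mul (hah_mem x).2 (mul_le_mul_of_nonneg_right hsl.2 (abs_nonneg _))
              (mul_nonneg hsl.1 (abs_nonneg _)) zero_le_one
        _ = Real.pi / 2 * |g x| := one_mul _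
  have b2 : ∫ x, ah x * (Fc (ρ x) * Γρ x) / (2 * ε) ≤
      Real.pi / 2 * ((K₁ + |c| + |2 * P.γ - c|) * (∫ x, ρ x) + ∫ x, |g x|) / ε := by
    rw [integral_div]
    have e : (∫ x, ah x * (Fc (ρ x) * Γρ x)) / (2 * ε) =
        ((1 / 2) * ∫ x, ah x * (Fc (ρ x) * Γρ x)) / ε := by
      field_simp
    rw [e]
    refine div_le_div_of_nonneg_right ?_ hε.le
    have : Real.pi / 2 * (K₁ + |c| + |2 * P.γ - c|) * (∫ x, ρ x) + Real.pi / 2 * ∫ x, |g x| =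
        Real.pi / 2 * ((K₁ + |c| + |2 * P.γ - c|) * (∫ x, ρ x) + ∫ x, |g x|) := by ring
    linarith [hfisher, hsrc]
  have eΦ : ∫ x, Φ x = Cc / Real.sqrt R *
      ((∫ x, sh.indicator (fun x => ε * W * (ρ x + δ)) x) + ∫ x, ah x * (Fc (ρ x) * Γρ x) / (2 * ε)) := by
    rw [hΦ, integral_const_mul, integral_add hi1 hi2]
  calc ∫ x, smoothCutoff (ρ x / M) * |carreDuChamp vL vR a ρ x|
      ≤ ∫ x, Φ x := integral_mono hi_lhs hiΦ hpt
    _ ≤ Cc / Real.sqrt R * (ε * W * ((∫ x, ρ x) + δ * (volume {x | P.hamiltonian N x ≤ 4 * R}).toReal) +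
          Real.pi / 2 * ((K₁ + |c| + |2 * P.γ - c|) * (∫ x, ρ x) + ∫ x, |g x|) / ε) := by
        rw [eΦ]
        exact mul_le_mul_of_nonneg_left (add_le_add b1 b2) (div_nonneg hCc0 (Real.sqrt_nonneg _))
    _ = _ := by rw [hCc, hW]


end Cross

/-- Registered helper (notation-free restatement of `half_integral_height_le_src`). -/
theorem helper_flipTruncationHeightTerm : ∀ (N : ℕ) (P : Literature.MathematicalPhysics.KineticTheory.HeatConduction.OscillatorChain), ContDiff ℝ ((⊤ : ℕ∞) : WithTop ℕ∞) P.U → ContDiff ℝ ((⊤ : ℕ∞) : WithTop ℕ∞) P.V → 0 < N → ∀ (T_L T_R : ℝ) (ρ : Literature.MathematicalPhysics.KineticTheory.HeatConduction.PhaseSpace N → ℝ), ContDiff ℝ 2 ρ → (∀ x, 0 ≤ ρ x) → MeasureTheory.Integrable ρ MeasureTheory.volume → ∀ (c : ℝ) (g : Literature.MathematicalPhysics.KineticTheory.HeatConduction.PhaseSpace N → ℝ), Continuous g → MeasureTheory.Integrable g MeasureTheory.volume → (∀ x, Literature.MathematicalPhysics.KineticTheory.sdeGenerator (fun y => -P.drift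 N y) (P.bathVecL N T_L) (P.bathVecR N T_R) ρ x + c * ρ x + g x = 0) → P.IsConfining → ∀ (M R K : ℝ), 0 < M → 0 < R → (∀ x, |Literature.MathematicalPhysics.KineticTheory.sdeGenerator (P.drift N) (P.bathVecL N T_L) (P.bathVecR N T_R) (fun y => Literature.MathematicalPhysics.KineticTheory.HeatConduction.smoothCutoff (P.hamiltonian N y / R)) x| ≤ K) → (1 / 2) * MeasureTheory.integral MeasureTheory.volume (fun x => Literature.MathematicalPhysics.KineticTheory.HeatConduction.smoothCutoff (P.hamiltonian N x / R) * (-(deriv Literature.MathematicalPhysics.KineticTheory.HeatConduction.smoothCutoff (ρ x / M) / M) * Literature.MathematicalPhysics.KineticTheory.carreDuChamp (P.bathVecL N T_L) (P.bathVecR N T_R) ρ ρ x)) ≤ 1 * (K + |c| + |2 * P.γ - c|) * MeasureTheory.integral MeasureTheory.volume (fun x => if M < ρ x then ρ x else 0) + MeasureTheory.integral MeasureTheory.volume (fun x => if M < ρ x then |g x| else 0) :=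
  fun _ _ hU hV hN _ _ _ hρ hρ0 hρi _ _ hg hgi hpde hP _ _ _ hM hR hK =>
    half_integral_height_le_src hU hV hN hρ hρ0 hρi hg hgi hpde hP hM hR hK

end Summit.AtomisticToContinuum.FouriersLaw.Theorems.NoisyFourier.FlipResolvent

end
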